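import Mathlib
import Summits.MatrixMultiplication.Statement
import Summits.MatrixMultiplication.MatrixMultiplication.Theorems.GraphEquationsAffineSecantPencil

/-!
# GraphEquations — correctness of an affine system is a property of its Jacobian field (M47;
cell `decomp-mm`, lens-5 g40)

Helper kernel beneath the attacked crux `MultiplicityReduction` (stmt-MatrixMultiplication-27806) of
route `GraphEquations`, rung `K = 3` (open content after g40: `AffSystem.AffineQuadricRigidity n`,
`n ≥ 3`).

**Every point of `ℂ^{3N}` lies on a secant line of the graph** (`secant_through`): for `s ∉ {0,1}` the
point `(A, B, AB + δ)` is `x_s` on the secant through the graph points over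
`(A − s·ΔA, B − s·1)` and `(A + (1−s)·ΔA, B + (1−s)·1)` with `ΔA = δ/(s(1−s))`.  Combined with the
secant pencil identity of M46 (`AffTest.eval_secant`) this gives

* `AffSystem.correct_iff_pencil` — for any fixed `s ∉ {0,1}`: `S` is CORRECT iff for all pairs of base
  points with `P := (A'−A)(B'−B) ≠ 0` some test has `⟨(1−s)J_g(A,B) + sJ_g(A',B'), P⟩ ≠ 0`.
  Correctness is thus a property of the JACOBIAN ROW FIELD `(A,B) ↦ (J_g(A,B))_g` on the graph
  alone — the quadratic parts `q_g` have disappeared into how `J` varies;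
* `AffSystem.correct_iff_pencil_two` — the instance `s = 2`: `⟨2J_g(A',B') − J_g(A,B), P⟩ ≠ 0`;
* `affineQuadricRigidity_iff_rowField` — **AQRₙ restated**: every row field
  `J_g(A,B) = κ_g + L_A^g A + L_B^g B + M_g(AB)` satisfying the pencil condition has full rank `N` at
  some point.  (Equivalently: an everywhere rank-deficient such field admits a pair of points with
  `P ≠ 0` and `P ⊥ 2J_g(A',B') − J_g(A,B)` for every `g`.)
* `AffSystem.Correct.pencil_transfer` — a curiosity forced by the equivalence: the pencil conditions
  for two different parameters `s, s' ∉ {0,1}` are equivalent.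

Sorry-free; no stub credit claimed.
-/

set_option linter.dupNamespace false
set_option linter.unusedSectionVars false

noncomputable section

namespace Summit.MatrixMultiplication.MatrixMultiplication.Theorems.GraphEquations

open Matrix

variable {n : ℕ}

/-! ## Every point lies on a secant of the graph -/

/-- The increment `ΔA = δ / (s(1−s))` used to pass a secant through `(A, B, AB + δ)`. -/
def secInc (δ : Vec n) (s : ℂ) : Vec n := (1 / (s * (1 - s))) • δ

/-- `ΔA · 1 = ΔA`: the product of the increments is `δ/(s(1−s))`. -/
theorem prodVec_secInc_idFun (δ : Vec n) (s : ℂ) : prodVec (secInc δ s) idFun = secInc δ s :=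
  prodVec_idFun _

/-- The `A`-blocks of the two graph points: `A − s·ΔA` and `A + (1−s)·ΔA` combine to `A`. -/
theorem secPt_through (A Δ : Vec n) (s : ℂ) : secPt (A - s • Δ) (A + (1 - s) • Δ) s = A := by
  funext q
  simp only [secPt, Pi.add_apply, Pi.sub_apply, Pi.smul_apply, smul_eq_mul]
  ring

/-- The difference of the two `A`-blocks is the increment. -/
theorem secPt_through_sub (A Δ : Vec n) (s : ℂ) : (A + (1 - s) • Δ) - (A - s • Δ) = Δ := by
  funext q
  simp only [Pi.add_apply, Pi.sub_apply, Pi.smul_apply, smul_eq_mul]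
  ring

/-- **Every point `(A, B, AB + δ)` is a secant point `x_s`** (`s ∉ {0,1}`): with
`A₁ = A − sΔA, A₂ = A + (1−s)ΔA, B₁ = B − s·1, B₂ = B + (1−s)·1`, `ΔA = δ/(s(1−s))`, the `C`-block of
`x_s` is `AB + δ`. -/
theorem secant_through (A B δ : Vec n) {s : ℂ} (hs0 : s ≠ 0) (hs1 : s ≠ 1) :
    secPt (prodVec (A - s • secInc δ s) (B - s • idFun))
        (prodVec (A + (1 - s) • secInc δ s) (B + (1 - s) • idFun)) s = prodVec A B + δ := by
  have hdef := secant_defect (A - s • secInc δ s) (A + (1 - s) • secInc δ s) (B - s • idFun)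
    (B + (1 - s) • idFun) s
  rw [secPt_through, secPt_through, secPt_through_sub, secPt_through_sub, prodVec_secInc_idFun]
    at hdef
  have hs : s * (1 - s) ≠ 0 := mul_ne_zero hs0 (sub_ne_zero.mpr (Ne.symm hs1))
  have hinc : (s * (1 - s)) • secInc δ s = δ := by
    rw [secInc, smul_smul, mul_one_div_cancel hs, one_smul]
  rw [hinc] at hdef
  exact eq_add_of_sub_eq' hdef

namespace AffSystem

variable {S : AffSystem n}

/-- **Correctness is a property of the Jacobian row field.**  For any fixed `s ∉ {0,1}`:
`S` is correct iff for all `A, A', B, B'` with `P = (A'−A)(B'−B) ≠ 0` some test has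
`⟨(1−s)J_g(A,B) + sJ_g(A',B'), P⟩ ≠ 0`. -/
theorem correct_iff_pencil {s : ℂ} (hs0 : s ≠ 0) (hs1 : s ≠ 1) :
    S.Correct ↔ ∀ A A' B B' : Vec n, prodVec (A' - A) (B' - B) ≠ 0 →
      ∃ i, ((1 - s) • (S.test i).jac A B + s • (S.test i).jac A' B') ⬝ᵥ prodVec (A' - A) (B' - B)
        ≠ 0 := by
  refine ⟨fun hC A A' B B' hP => hC.exists_pencil_ne_zero hs0 hs1 hP, fun h A B C hall => ?_⟩
  by_contra hne
  set δ : Vec n := C - prodVec A B with hδ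
  have hδ0 : δ ≠ 0 := fun h0 => hne (sub_eq_zero.mp h0)
  have hs : s * (1 - s) ≠ 0 := mul_ne_zero hs0 (sub_ne_zero.mpr (Ne.symm hs1))
  -- the two graph points
  set A₁ : Vec n := A - s • secInc δ s
  set A₂ : Vec n := A + (1 - s) • secInc δ s
  set B₁ : Vec n := B - s • idFun
  set B₂ : Vec n := B + (1 - s) • idFun
  have hA : secPt A₁ A₂ s = A := secPt_through A _ s
  have hB : secPt B₁ B₂ s = B := secPt_through B _ s
  have hCpt : secPt (prodVec A₁ B₁) (prodVec A₂ B₂) s = C := by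
    rw [secant_through A B δ hs0 hs1, hδ, add_sub_cancel]
  have hP : prodVec (A₂ - A₁) (B₂ - B₁) = secInc δ s := by
    rw [secPt_through_sub, secPt_through_sub, prodVec_secInc_idFun]
  have hP0 : prodVec (A₂ - A₁) (B₂ - B₁) ≠ 0 := by
    rw [hP, secInc]
    exact smul_ne_zero (one_div_ne_zero hs) hδ0
  obtain ⟨i, hi⟩ := h A₁ A₂ B₁ B₂ hP0
  have hev := (S.test i).eval_secant A₁ A₂ B₁ B₂ s
  rw [hA, hB, hCpt, hall i] at hev
  exact hi ((mul_eq_zero.mp hev.symm).resolve_left hs)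

/-- **The instance `s = 2`:** `S` is correct iff for all pairs with `P = (A'−A)(B'−B) ≠ 0` some test
has `⟨2J_g(A',B') − J_g(A,B), P⟩ ≠ 0`. -/
theorem correct_iff_pencil_two :
    S.Correct ↔ ∀ A A' B B' : Vec n, prodVec (A' - A) (B' - B) ≠ 0 →
      ∃ i, ((2 : ℂ) • (S.test i).jac A' B' - (S.test i).jac A B) ⬝ᵥ prodVec (A' - A) (B' - B)
        ≠ 0 := by
  rw [correct_iff_pencil (s := 2) two_ne_zero (by norm_num)]
  refine forall₄_congr fun A A' B B' => imp_congr_right fun _ => exists_congr fun i => ?_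
  rw [show (1 : ℂ) - 2 = -1 by norm_num, neg_one_smul, neg_add_eq_sub]

/-- **Pencil transfer** (forced by the equivalence): the pencil conditions at two parameters
`s, s' ∉ {0,1}` are equivalent. -/
theorem Correct.pencil_transfer {s s' : ℂ} (hs0 : s ≠ 0) (hs1 : s ≠ 1) (hs0' : s' ≠ 0)
    (hs1' : s' ≠ 1)
    (h : ∀ A A' B B' : Vec n, prodVec (A' - A) (B' - B) ≠ 0 →
      ∃ i, ((1 - s) • (S.test i).jac A B + s • (S.test i).jac A' B') ⬝ᵥ prodVec (A' - A) (B' - B)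
        ≠ 0)
    {A A' B B' : Vec n} (hP : prodVec (A' - A) (B' - B) ≠ 0) :
    ∃ i, ((1 - s') • (S.test i).jac A B + s' • (S.test i).jac A' B') ⬝ᵥ prodVec (A' - A) (B' - B)
      ≠ 0 :=
  ((correct_iff_pencil hs0 hs1).mpr h).exists_pencil_ne_zero hs0' hs1' hP

end AffSystem

/-- **AQRₙ restated on the row field.**  Affine–quadric rigidity holds at `n` iff every affine system
whose Jacobian row field passes the pencil test (`s = 2`) has full rank somewhere. -/
theorem AffSystem.affineQuadricRigidity_iff_rowField :
    AffSystem.AffineQuadricRigidity n ↔ ∀ S : AffSystem n,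
      (∀ A A' B B' : Vec n, prodVec (A' - A) (B' - B) ≠ 0 →
        ∃ i, ((2 : ℂ) • (S.test i).jac A' B' - (S.test i).jac A B) ⬝ᵥ prodVec (A' - A) (B' - B)
          ≠ 0) → ∃ A B : Vec n, S.ReducedAt A B := by
  refine forall_congr' fun S => ?_
  rw [AffSystem.correct_iff_pencil_two]

/-- **The counterexample reading.**  AQRₙ fails iff some affine system is nowhere of full rank and yet
passes the pencil test. -/
theorem AffSystem.not_affineQuadricRigidity_iff :
    ¬ AffSystem.AffineQuadricRigidity n ↔ ∃ S : AffSystem n, S.NowhereReduced ∧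
      ∀ A A' B B' : Vec n, prodVec (A' - A) (B' - B) ≠ 0 →
        ∃ i, ((2 : ℂ) • (S.test i).jac A' B' - (S.test i).jac A B) ⬝ᵥ prodVec (A' - A) (B' - B)
          ≠ 0 := by
  rw [AffSystem.affineQuadricRigidity_iff_rowField]
  constructor
  · intro h
    obtain ⟨S, hS⟩ := not_forall.mp h
    obtain ⟨hp, hnr⟩ := Classical.not_imp.mp hS
    exact ⟨S, fun A B hR => hnr ⟨A, B, hR⟩, hp⟩
  · rintro ⟨S, hnr, hp⟩ h
    obtain ⟨A, B, hR⟩ := h S hp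
    exact hnr A B hR

end Summit.MatrixMultiplication.MatrixMultiplication.Theorems.GraphEquations

end
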